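import Mathlib.FieldTheory.Finite.Basic
import Mathlib.RingTheory.AdjoinRoot
import Mathlib.Algebra.Squarefree.Basic
import Mathlib.RingTheory.Polynomial.Basic
import Mathlib.RingTheory.UniqueFactorizationDomain.Basic
import HarnessLib

/-!
# Berlekamp's subalgebra: the algebra behind factoring modulo `p` (LLL 1982, §3, step (3.1))

Support file for the discharge of the named fact
`Literature.Computability.Complexity.lll_monicIrreducible_mem_P` (irreducibility of monic integer
polynomials is decidable in `P`; Lenstra–Lenstra–Lovász 1982, §3). Step (3.1) of the LLL
algorithm factors `f mod p` for a small prime `p` "with Berlekamp's algorithm"; what the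
irreducibility test needs is ONE monic irreducible factor of a squarefree `f ∈ 𝔽_q[X]`, found by
repeatedly splitting `f` with elements of Berlekamp's subalgebra
`B = {v mod f : v^q ≡ v (mod f)}`. This file proves the three algebraic facts on which that
loop rests, for a finite field `F` with `q` elements:

* `exists_berlekamp_of_not_irreducible` — if `f` is monic, squarefree, of positive degree and NOT
  irreducible, then some `v` with `deg v < deg f`, `deg v > 0` satisfies `f ∣ v^q - v` (Chinese
  remainder theorem: `v ≡ 0 (mod f₁)`, `v ≡ 1 (mod f₂)` for a coprime splitting `f = f₁ f₂`);
  `exists_berlekamp_coeff_zero_of_not_irreducible` — moreover with `v(0) = 0` (the unknowns of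
  the linear system are `v₁, …, v_{deg f - 1}`);
* `exists_eq_algebraMap_of_pow_card_eq` — in any field extension `K/F`, the solutions of
  `y^q = y` are exactly the elements of `F` (the `q` roots of `X^q - X`);
* `exists_not_isCoprime_not_dvd_sub_C` — **Berlekamp's splitting**: if `f ∣ v^q - v` with
  `0 < deg v < deg f`, then for some `s ∈ F` the polynomial `v - s` has a nontrivial common factor
  with `f` without being a multiple of `f`, i.e. `0 < deg gcd(f, v - s) < deg f`;
* `pow_card_modByMonic_eq_sum` — the map `v ↦ v^q mod f` is `F`-linear in the coefficients of
  `v`: `v^q mod f = Σᵢ vᵢ (X^{iq} mod f)` (Frobenius = `expand q`), so that `B` is the kernel of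
  an explicit matrix (Berlekamp's `Q - I`).

Everything is proved; the algorithm on coefficient lists and its running time are elsewhere.

## Mathlib / tree search

Mathlib has finite fields (`FiniteField.pow_card`, `FiniteField.expand_card : expand q f = f^q`,
`X_pow_card_sub_X_natDegree_eq`, `roots_X_pow_card_sub_X` for the field itself), `AdjoinRoot`,
`modByMonicHom`, but no Berlekamp algebra / factoring over finite fields
(`lean search 'Berlekamp|berlekamp'`: only docstring mentions in the tree's `ListKernel.lean`,
whose `ListGauss.kerVec` is the kernel-vector program the loop will call).

## References

* A. K. Lenstra, H. W. Lenstra Jr., L. Lovász, *Factoring polynomials with rational coefficients*,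
  Math. Ann. 261 (1982) 515–534, §3, (3.1) and the proof of (3.6) ("we apply Berlekamp's
  algorithm [Knuth §4.6.2]"). [LenstraLenstraLovasz1982]
* E. R. Berlekamp, *Factoring polynomials over finite fields*, Bell System Tech. J. 46 (1967)
  1853–1859.
* D. E. Knuth, *The Art of Computer Programming*, Vol. 2, 3rd ed., §4.6.2 (Berlekamp's algorithm:
  the subalgebra `v^p ≡ v`, splitting by `gcd(f, v - s)`, `0 ≤ s < p`). [KnuthTAOCP2]
* M. R. Bremner, *Lattice Basis Reduction*, CRC Press 2011, §15.2–15.4 (structure of `𝔽_q[x]/(f)`,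
  distinct/equal-degree decomposition). [Bremner2011] (held: book:bremnernd-lattice-basis-reduction)
-/

noncomputable section

open Polynomial Finset

namespace Literature.Computability.Complexity

namespace LLLFactoring

variable {F : Type*} [Field F] [Fintype F]

/-! ### Existence of a nonconstant element of Berlekamp's subalgebra -/

/-- **A reducible squarefree polynomial has a nonconstant Berlekamp element.** If `f ∈ F[X]`
(`|F| = q`) is monic, squarefree and not irreducible, of positive degree, then there is `v` with
`0 < deg v < deg f` and `f ∣ v^q - v`. (Write `f = f₁ f₂` with `f₁` irreducible; squarefreeness
makes `f₁, f₂` coprime, and the CRT solution of `v ≡ 0 (f₁)`, `v ≡ 1 (f₂)` reduced modulo `f`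
works, since `0^q = 0` and `1^q = 1`.) [cite: KnuthTAOCP2, §4.6.2 (dimension of the Berlekamp subalgebra = number of irreducible factors)] -/
theorem exists_berlekamp_of_not_irreducible {f : F[X]} (hmo : f.Monic) (hsq : Squarefree f)
    (hdeg : 0 < f.natDegree) (hirr : ¬Irreducible f) :
    ∃ v : F[X], 0 < v.natDegree ∧ v.natDegree < f.natDegree ∧ f ∣ v ^ Fintype.card F - v := by
  classical
  set q := Fintype.card F with hq
  have hf0 : f ≠ 0 := hmo.ne_zero
  have hfu : ¬IsUnit f := fun h => by
    have := natDegree_eq_zero_of_isUnit h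
    omega
  obtain ⟨f₁, hirr₁, f₂, rfl⟩ := WfDvdMonoid.exists_irreducible_factor hfu hf0
  -- `f₂` is not a unit (else `f` would be irreducible) and is coprime to `f₁` (squarefree)
  have hf₂u : ¬IsUnit f₂ := fun h => hirr ((irreducible_mul_isUnit h).2 hirr₁)
  have hcop : IsCoprime f₁ f₂ := by
    rw [hirr₁.coprime_iff_not_dvd]
    rintro ⟨c, rfl⟩
    have hsq1 : f₁ * f₁ ∣ f₁ * (f₁ * c) := ⟨c, by ring⟩
    exact hirr₁.not_isUnit (hsq f₁ hsq1)
  obtain ⟨a, b, hab⟩ := hcop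
  -- the CRT element `v₀ = a f₁ ≡ 0 (f₁), ≡ 1 (f₂)`, reduced modulo `f`
  set v₀ : F[X] := a * f₁ with hv₀
  set v : F[X] := v₀ %ₘ (f₁ * f₂) with hv
  have hvv₀ : f₁ * f₂ ∣ v - v₀ := by
    have := dvd_modByMonic_sub v₀ (f₁ * f₂)
    rwa [← hv] at this
  have h₁v₀ : f₁ ∣ v₀ := ⟨a, by rw [hv₀]; ring⟩
  have h₂v₀ : f₂ ∣ v₀ - 1 := ⟨-b, by rw [hv₀]; linear_combination hab⟩
  refine ⟨v, ?_, ?_, ?_⟩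
  · -- `v` is not constant
    by_contra hc
    push Not at hc
    have hc0 : v.natDegree = 0 := Nat.le_zero.1 hc
    obtain ⟨c, hc⟩ : ∃ c, v = C c := ⟨v.coeff 0, eq_C_of_natDegree_eq_zero hc0⟩
    -- `f₁ ∣ v`, so `v = 0`
    have h₁v : f₁ ∣ v := by
      have : f₁ ∣ v - v₀ := dvd_trans (dvd_mul_right f₁ f₂) hvv₀
      simpa using dvd_add this h₁v₀
    have hvz : v = 0 := by
      rw [hc] at h₁v ⊢
      by_contra hcz
      have hcu : IsUnit (C c) := isUnit_C.2 (Ne.isUnit fun h => hcz (by rw [h, map_zero]))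
      exact hirr₁.not_isUnit (isUnit_of_dvd_unit h₁v hcu)
    -- `f₂ ∣ v - 1 = -1`, so `f₂` is a unit
    have h₂v : f₂ ∣ v - 1 := by
      have : f₂ ∣ v - v₀ := dvd_trans (dvd_mul_left f₂ f₁) hvv₀
      have h' := dvd_add this h₂v₀
      simpa using h'
    rw [hvz, zero_sub] at h₂v
    exact hf₂u (isUnit_of_dvd_unit h₂v isUnit_one.neg)
  · -- `deg v < deg f`
    have hne : f₁ * f₂ ≠ 1 := fun h => hfu (h ▸ isUnit_one)
    rw [hv]
    exact natDegree_modByMonic_lt v₀ hmo hne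
  · -- `f ∣ v^q - v`: modulo `f₁` both sides vanish, modulo `f₂` `v ≡ 1`
    have key : f₁ * f₂ ∣ v₀ ^ q - v₀ := by
      refine IsCoprime.mul_dvd ⟨a, b, hab⟩ ?_ ?_
      · have hq1 : 1 ≤ q := Fintype.card_pos
        have : v₀ ∣ v₀ ^ q - v₀ := by
          refine ⟨v₀ ^ (q - 1) - 1, ?_⟩
          rw [mul_sub, mul_one, ← pow_succ', Nat.sub_add_cancel hq1]
        exact dvd_trans h₁v₀ this
      · have h1 : v₀ - 1 ∣ v₀ ^ q - 1 ^ q := sub_dvd_pow_sub_pow v₀ 1 q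
        rw [one_pow] at h1
        have : v₀ ^ q - v₀ = (v₀ ^ q - 1) - (v₀ - 1) := by ring
        rw [this]
        exact dvd_sub (dvd_trans h₂v₀ h1) h₂v₀
    have hdiff : v - v₀ ∣ (v ^ q - v) - (v₀ ^ q - v₀) := by
      have : (v ^ q - v) - (v₀ ^ q - v₀) = (v ^ q - v₀ ^ q) - (v - v₀) := by ring
      rw [this]
      exact dvd_sub (sub_dvd_pow_sub_pow v v₀ q) dvd_rfl
    have := dvd_add (dvd_trans hvv₀ hdiff) key
    simpa using this

/-- The same with vanishing constant term: subtracting the constant `v(0)` keeps `f ∣ v^q - v`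
(`c^q = c` in `F`) and the degree. [cite: KnuthTAOCP2, §4.6.2] -/
theorem exists_berlekamp_coeff_zero_of_not_irreducible {f : F[X]} (hmo : f.Monic) (hsq : Squarefree f)
    (hdeg : 0 < f.natDegree) (hirr : ¬Irreducible f) :
    ∃ v : F[X], v.coeff 0 = 0 ∧ 0 < v.natDegree ∧ v.natDegree < f.natDegree ∧
      f ∣ v ^ Fintype.card F - v := by
  obtain ⟨v, hv0, hvf, hdvd⟩ := exists_berlekamp_of_not_irreducible hmo hsq hdeg hirr
  refine ⟨v - C (v.coeff 0), by simp, by rwa [natDegree_sub_C], by rwa [natDegree_sub_C], ?_⟩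
  have hfrob : (v - C (v.coeff 0)) ^ Fintype.card F = v ^ Fintype.card F - C (v.coeff 0) := by
    rw [← FiniteField.expand_card, map_sub, expand_C, FiniteField.expand_card]
  rw [hfrob]
  have : v ^ Fintype.card F - C (v.coeff 0) - (v - C (v.coeff 0)) = v ^ Fintype.card F - v := by ring
  rwa [this]

/-! ### Frobenius-fixed elements of an extension are the ground field -/

/-- In a field extension `K` of the finite field `F` (`|F| = q`), every solution of `y^q = y` lies
in `F`: the `q` elements of `F` are roots of `X^q - X`, which has at most `q` roots.
[cite: Bremner2011, §15.2 (structure theory of finite fields)] -/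
theorem exists_eq_algebraMap_of_pow_card_eq {K : Type*} [Field K] [Algebra F K] {y : K}
    (hy : y ^ Fintype.card F = y) : ∃ s : F, algebraMap F K s = y := by
  classical
  set q := Fintype.card F with hq
  have hq1 : 1 < q := Fintype.one_lt_card
  set P : K[X] := X ^ q - X with hP
  have hP0 : P ≠ 0 := FiniteField.X_pow_card_sub_X_ne_zero K hq1
  have hPdeg : P.natDegree = q := FiniteField.X_pow_card_sub_X_natDegree_eq K hq1
  -- the image of `F` consists of roots of `P`
  have hsub : (univ : Finset F).image (algebraMap F K) ⊆ P.roots.toFinset := by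
    intro z hz
    obtain ⟨s, -, rfl⟩ := mem_image.1 hz
    rw [Multiset.mem_toFinset, mem_roots hP0, IsRoot, hP, eval_sub, eval_pow, eval_X,
      ← map_pow, FiniteField.pow_card, sub_self]
  have hcard : P.roots.toFinset.card ≤ ((univ : Finset F).image (algebraMap F K)).card := by
    rw [Finset.card_image_of_injective _ (algebraMap F K).injective, card_univ, ← hq, ← hPdeg]
    exact (Multiset.toFinset_card_le _).trans (card_roots' P)
  have heq := Finset.eq_of_subset_of_card_le hsub hcard
  have hyr : y ∈ P.roots.toFinset := by
    rw [Multiset.mem_toFinset, mem_roots hP0, IsRoot, hP, eval_sub, eval_pow, eval_X, hy, sub_self]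
  rw [← heq] at hyr
  obtain ⟨s, -, hs⟩ := mem_image.1 hyr
  exact ⟨s, hs⟩

/-! ### Berlekamp's splitting -/

/-- **Berlekamp's splitting step.** Let `f ∈ F[X]` (`|F| = q`) and let `v` satisfy
`f ∣ v^q - v` with `0 < deg v < deg f`. Then for some `s ∈ F`, `v - s` and `f` are not coprime
while `f ∤ v - s`; consequently `gcd(f, v - s)` is a proper nontrivial factor of `f`. (Modulo an
irreducible factor `h` of `f`, `v` is Frobenius-fixed in the field `F[X]/(h)`, hence congruent to
a constant `s`; and `f ∤ v - s` by degrees.) [cite: KnuthTAOCP2, §4.6.2 (gcd(f, v - s), 0 ≤ s < p)] [cite: LenstraLenstraLovasz1982, (3.1)] -/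
theorem exists_not_isCoprime_not_dvd_sub_C {f v : F[X]} (hdvd : f ∣ v ^ Fintype.card F - v)
    (hv0 : 0 < v.natDegree) (hvf : v.natDegree < f.natDegree) :
    ∃ s : F, ¬IsCoprime f (v - C s) ∧ ¬(f ∣ v - C s) := by
  classical
  have hf0 : f ≠ 0 := by rintro rfl; simp at hvf
  have hfu : ¬IsUnit f := fun h => by
    have := natDegree_eq_zero_of_isUnit h
    omega
  obtain ⟨h, hirr, hhf⟩ := WfDvdMonoid.exists_irreducible_factor hfu hf0
  haveI : Fact (Irreducible h) := ⟨hirr⟩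
  -- in `K = F[X]/(h)` the class of `v` is Frobenius-fixed, hence a constant
  set y : AdjoinRoot h := AdjoinRoot.mk h v with hy
  have hyq : y ^ Fintype.card F = y := by
    have h0 : AdjoinRoot.mk h (v ^ Fintype.card F - v) = 0 :=
      AdjoinRoot.mk_eq_zero.2 (dvd_trans hhf hdvd)
    rw [map_sub, map_pow, sub_eq_zero] at h0
    exact h0
  obtain ⟨s, hs⟩ := exists_eq_algebraMap_of_pow_card_eq hyq
  have hhs : h ∣ v - C s := by
    rw [← AdjoinRoot.mk_eq_zero, map_sub, AdjoinRoot.mk_C, ← hy, ← hs, AdjoinRoot.algebraMap_eq,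
      sub_self]
  refine ⟨s, fun hcop => hirr.not_isUnit (hcop.isUnit_of_dvd' hhf hhs), fun hfd => ?_⟩
  have hne : v - C s ≠ 0 := fun h0 => by
    have := congrArg natDegree h0
    rw [natDegree_sub_C, natDegree_zero] at this
    omega
  have := natDegree_le_of_dvd hfd hne
  rw [natDegree_sub_C] at this
  omega

/-- Degree form of the splitting step for the normalised `gcd` of `F[X]`:
`0 < deg gcd(f, v - s) < deg f` for some `s`. [cite: KnuthTAOCP2, §4.6.2] -/
theorem exists_natDegree_gcd_sub_C [DecidableEq F] {f v : F[X]} (hdvd : f ∣ v ^ Fintype.card F - v)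
    (hv0 : 0 < v.natDegree) (hvf : v.natDegree < f.natDegree) :
    ∃ s : F, 0 < (gcd f (v - C s)).natDegree ∧ (gcd f (v - C s)).natDegree < f.natDegree := by
  obtain ⟨s, hnc, hnd⟩ := exists_not_isCoprime_not_dvd_sub_C hdvd hv0 hvf
  have hf0 : f ≠ 0 := by rintro rfl; simp at hvf
  refine ⟨s, ?_, ?_⟩
  · by_contra h0
    push Not at h0
    have hg0 : gcd f (v - C s) ≠ 0 := fun h => hf0 ((gcd_eq_zero_iff _ _).1 h).1
    have hunit : IsUnit (gcd f (v - C s)) := by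
      rw [Nat.le_zero, natDegree_eq_zero] at h0
      obtain ⟨c, hc⟩ := h0
      rw [← hc]
      refine isUnit_C.2 (Ne.isUnit ?_)
      rintro rfl
      exact hg0 (by rw [← hc, map_zero])
    exact hnc ((gcd_isUnit_iff _ _).1 hunit)
  · have hle : (gcd f (v - C s)).natDegree ≤ f.natDegree := natDegree_le_of_dvd (gcd_dvd_left _ _) hf0
    refine lt_of_le_of_ne hle fun heq => hnd ?_
    -- equal degrees: `f` and the gcd are associated, so `f ∣ v - C s`
    have hfd : f ∣ gcd f (v - C s) := by
      obtain ⟨c, hc⟩ := gcd_dvd_left f (v - C s)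
      have hc0 : c ≠ 0 := by rintro rfl; rw [mul_zero] at hc; exact hf0 hc
      have hcdeg : c.natDegree = 0 := by
        have := congrArg natDegree hc
        rw [natDegree_mul (fun h => hf0 (by rw [hc, h, zero_mul])) hc0, heq] at this
        omega
      have hcu : IsUnit c := by
        rw [natDegree_eq_zero] at hcdeg
        obtain ⟨d, rfl⟩ := hcdeg
        exact isUnit_C.2 (Ne.isUnit fun h => hc0 (by rw [h, map_zero]))
      refine ⟨(↑hcu.unit⁻¹ : F[X]), ?_⟩
      calc gcd f (v - C s) = gcd f (v - C s) * (c * ↑hcu.unit⁻¹) := by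
            rw [IsUnit.mul_val_inv, mul_one]
        _ = f * ↑hcu.unit⁻¹ := by rw [← mul_assoc, ← hc]
    exact dvd_trans hfd (gcd_dvd_right _ _)

/-! ### Linearity of `v ↦ v^q mod f` -/

/-- **Frobenius is linear on coefficients**: for `f` monic and any `v ∈ F[X]` (`|F| = q`),
`v^q mod f = Σ_{i ≤ deg v} vᵢ · (X^{q i} mod f)`; so `{v : deg v < deg f, f ∣ v^q - v}` is the
kernel of the matrix `Q - I` whose `i`-th row holds the coefficients of `X^{iq} mod f`
(Berlekamp's matrix). [cite: KnuthTAOCP2, §4.6.2 (the matrix Q)] -/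
theorem pow_card_modByMonic_eq_sum {f : F[X]} (v : F[X]) :
    (v ^ Fintype.card F) %ₘ f =
      ∑ i ∈ range (v.natDegree + 1), v.coeff i • ((X ^ (Fintype.card F * i)) %ₘ f) := by
  have hexp : v ^ Fintype.card F = ∑ i ∈ range (v.natDegree + 1), v.coeff i • X ^ (Fintype.card F * i) := by
    rw [← FiniteField.expand_card, expand_eq_sum, sum_over_range]
    · refine Finset.sum_congr rfl fun i _ => ?_
      rw [smul_eq_C_mul, ← pow_mul]
    · intro i; simp
  rw [hexp]
  have := map_sum (modByMonicHom f) (fun i => v.coeff i • X ^ (Fintype.card F * i)) (range (v.natDegree + 1))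
  simp only [modByMonicHom_apply, map_smul] at this ⊢
  convert this using 1

/-- Membership in Berlekamp's subalgebra as a linear condition: for `f` monic of positive degree
and `deg v < deg f`, `f ∣ v^q - v ↔ Σᵢ vᵢ (X^{iq} mod f) = v`. [cite: KnuthTAOCP2, §4.6.2] -/
theorem dvd_pow_card_sub_iff_sum_eq {f v : F[X]} (hmo : f.Monic) (hvf : v.degree < f.degree) :
    f ∣ v ^ Fintype.card F - v ↔
      ∑ i ∈ range (v.natDegree + 1), v.coeff i • ((X ^ (Fintype.card F * i)) %ₘ f) = v := by
  rw [← pow_card_modByMonic_eq_sum, ← modByMonic_eq_zero_iff_dvd hmo, sub_modByMonic,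
    (modByMonic_eq_self_iff hmo).2 hvf, sub_eq_zero]

end LLLFactoring

end Literature.Computability.Complexity
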